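import Mathlib
import HarnessLib
import Summits.NavierStokesRegularity.NavierStokesRegularity.Theorems.LocalTiltingFreeDoorAxisymmetricSwirl
import Summits.NavierStokesRegularity.FluidComputer.AngularGalerkinLadderRotation
import Summits.NavierStokesRegularity.NavierStokesRegularity.Theorems.LocalTiltingFreeDoorDirectionLine
import Summits.NavierStokesRegularity.NavierStokesRegularity.Theorems.LocalTiltingFreeDoorTarget
import Summits.NavierStokesRegularity.NavierStokesRegularity.Theorems.PoloidalWindowDoorPoloidalWindowRigidityLocalVorticitySymmetry
import Summits.NavierStokesRegularity.NavierStokesRegularity.Theorems.PoloidalWindowDoorPoloidalWindowRigidityEntireGerm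

/-!
# nsreg-p1 ROUND-18 door S19 «LocalTiltingFreeDoor» — LINE 2 «tilting symmetry germ»: the classical stub
# `stub_symmetricGermsRegular` (M⁺) PROVED, and the DOOR CLOSED MODULO ITS SINGLE HARD STUB TSG (by name)

Door S19 (nsreg-p1 g16, `HOME/ns-regularity-ideate-p1/ROUND-18.md`; DESIGN-ONLY, route NOT born), LINE 2 skeleton
`r18/TiltingSymmetryGerm_line.lean` 5d1e8887fb878af2: `stub_windowSpread` (M, tree
`…LocalTiltingFreeDoorDirectionLine.tiltingWindowToSlab`) → `stub_tiltingSymmetryGerm` (HARD′, «TSG», OPEN) →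
`stub_symmetricGermsRegular` (M⁺).  TSG outputs, on one slice and one window where `curl v(s) ≠ 0`, EITHER an
infinitesimal Euclidean Killing symmetry of the VORTICITY, `D(curl v(s))(y)[a × (y − c) + b] = a × curl v(s)(y)` with
`(a,b) ≠ (0,0)`, OR agreement of `v(s)` with an entire field of unbounded norm.  Every branch empties:

* `eq_zero_of_killingGerm_slice` — **the Killing branch in full**, any axis direction `a`, any `b`, `c`: `a = 0` is a
  translation germ (`…LocalVorticitySymmetry.curl_translate_of_fderiv_eq_zero_on` + stratum (A)); for `a ≠ 0` the
  normal form `b = a × d + κa` (`cross_decomposition`, BAC–CAB) and conjugation by a linear isometry `L` with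
  `L⁻¹e₃ = a/‖a‖` composed with the translation by `c − d` (pseudo-vector laws `curl_conj_linearIsometryEquiv` and the tree's
  `…FluidComputer.AngularLadder.cross_map_linearIsometryEquiv`) turn the identity into the vertical screw clause `Dω_w(x)[J x + εκ e₃] = J ω_w(x)`
  on an open set, hence everywhere (analyticity); `κ = 0`: the vorticity slice is axisymmetric and
  `…AxisymmetricSwirl.eq_zero_of_curl_isAxisymmetric_slice_of_cylBound` (KNSS Thm 5.3, SWIRL ALLOWED) ends; `κ ≠ 0`:
  integrating (`screw_equivariant`) one full turn is the translation by `2πεκ e₃ ≠ 0`, so the vorticity and then the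
  velocity slice are periodic (`periodic_of_curl_periodic`); a periodic slice small at infinity vanishes, and a zero
  slice is translation-invariant (`eq_zero_of_translate_eq_slice`);
* `screwVorticityGermRegular` (the planner's named residual of LINE 2 v2/v3) and `symmetricGermsRegular`
  (= **`stub_symmetricGermsRegular`**), texts verbatim, PROVED (irrotational slice: `eq_zero_of_curl_eq_zero_on_open`; entire
  branch: `…EntireGerm.not_slice_eqOn_open_of_not_bddAbove`);
* `tiltingFreeProfileRigidity_of_tiltingSymmetryGerm`, `target_of_tiltingSymmetryGerm`, `target_of_directionRigidity` —
  K2 `TiltingFreeProfileRigidity` and the door `Target` (texts of `r18/Sketch19.lean`, verbatim) FROM THE TEXT OF ONE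
  HARD STUB (TSG, resp. LINE 1's `stub_directionRigidity`): S19 = door modulo exactly one named statement, both lines.
  `tiltingFreeProfileRigidity_of_directionRigiditySlice`: LINE 1 needs only SOME unidirectional slice (candidate reshape
  of its hard stub, via `…DirectionLine.eq_zero_of_curl_parallel_slice`).

Seat nsreg-p6 g10 (THEOREMS-ONLY door sequels, DIRECTOR-NS g8 #32 (2)/#36).  WHAT THIS IS NOT: not NS regularity (Clay A); not
K2, not TSG / `stub_directionRigidity` (OPEN; GGH97 §6 Q1 made precise) — the census-independent half of LINE 2; no route is opened.
-/

noncomputable section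

-- the summit and its single sub-problem share the name (CONVENTIONS §1), as in every Theorems file
set_option linter.dupNamespace false

namespace Summit.NavierStokesRegularity.NavierStokesRegularity.Theorems.LocalTiltingFreeDoorSymmetricGerms

open MeasureTheory Set Function Filter Topology Metric
open scoped RealInnerProductSpace InnerProductSpace
open Literature.Analysis Literature.Analysis.FluidPDE
open Summit.NavierStokesRegularity.NavierStokesRegularity.Theorems.LocalSineTubeDoorProfileAlignedWindowRigidityAncient
open Summit.NavierStokesRegularity.NavierStokesRegularity.Theorems.PoloidalWindowDoorPoloidalWindowRigidityFlat (not_backwardSingular_of_zero)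
open Summit.NavierStokesRegularity.NavierStokesRegularity.Theorems.PoloidalWindowDoorPoloidalWindowRigidityAxisymmetric (class_translate)
open Summit.NavierStokesRegularity.NavierStokesRegularity.Theorems.PoloidalWindowDoorPoloidalWindowRigidityRotate (class_conj_linearIsometryEquiv exists_linearIsometryEquiv_symm_single_two)
open Summit.NavierStokesRegularity.NavierStokesRegularity.Theorems.PoloidalWindowDoorPoloidalWindowRigidityOneSlice (eq_zero_of_translate_eq_slice)
open Summit.NavierStokesRegularity.NavierStokesRegularity.Theorems.PoloidalWindowDoorPoloidalWindowRigidityVorticityTranslate (periodic_of_curl_periodic eq_zero_of_curl_translate_eq_slice)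
open Summit.NavierStokesRegularity.NavierStokesRegularity.Theorems.PoloidalWindowDoorPoloidalWindowRigidityLocalVorticitySymmetry (analyticOnNhd_curl_slice curl_translate_of_fderiv_eq_zero_on)
open Summit.NavierStokesRegularity.NavierStokesRegularity.Theorems.PoloidalWindowDoorPoloidalWindowRigiditySymmetryGerms
  (eq_of_eqOn_open analyticOnNhd_fderiv_apply analyticOnNhd_rotGen isAxisymmetric_of_rotDefect_eq_zero
    eq_zero_of_curl_eq_zero_on_open)
open Summit.NavierStokesRegularity.NavierStokesRegularity.Theorems.PoloidalWindowDoorPoloidalWindowRigidityEntireGerm (not_slice_eqOn_open_of_not_bddAbove)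
open Summit.NavierStokesRegularity.NavierStokesRegularity.Theorems.SymmetricLiouville.Negative (screw_equivariant ez)
open Summit.NavierStokesRegularity.NavierStokesRegularity.Theorems.LocalTiltingFreeDoorAxisymmetricSwirl
open Summit.NavierStokesRegularity.FluidComputer.AngularLadder (cross_map_linearIsometryEquiv symm_cross_eq)

variable {C D : ℝ} {v : ℝ → EuclideanSpace ℝ (Fin 3) → EuclideanSpace ℝ (Fin 3)}

/-! ### Cross-product algebra: normal form of a Killing field -/

/-- `J x = e₃ × x`. -/
theorem rotGen_eq_cross (x : EuclideanSpace ℝ (Fin 3)) : rotGen x = cross (EuclideanSpace.single 2 (1 : ℝ)) x := by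
  ext i
  fin_cases i <;> simp [rotGen, cross, cross_apply]

/-- The cross product is linear in each slot (packaged). -/
theorem cross_add_right (a x y : EuclideanSpace ℝ (Fin 3)) : cross a (x + y) = cross a x + cross a y := by
  rw [← crossCLM_apply, map_add, crossCLM_apply, crossCLM_apply]

/-- Scalars pull out of the first slot. -/
theorem cross_smul_left (a x : EuclideanSpace ℝ (Fin 3)) (r : ℝ) : cross (r • a) x = r • cross a x := by
  rw [← crossCLM_apply, map_smul]
  rfl

/-- **Normal form of a Euclidean Killing field**: for `a ≠ 0`, `b = a × d + κ a` with `d = (b × a)/‖a‖²`,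
`κ = ⟪a,b⟫/‖a‖²` (BAC–CAB). -/
theorem cross_decomposition {a : EuclideanSpace ℝ (Fin 3)} (ha : a ≠ 0) (b : EuclideanSpace ℝ (Fin 3)) :
    cross a ((‖a‖ ^ 2)⁻¹ • cross b a) + (⟪a, b⟫_ℝ / ‖a‖ ^ 2) • a = b := by
  have hn : ‖a‖ ^ 2 = a 0 ^ 2 + a 1 ^ 2 + a 2 ^ 2 := by
    rw [EuclideanSpace.norm_eq, Real.sq_sqrt (by positivity), Fin.sum_univ_three]
    simp only [Real.norm_eq_abs, sq_abs]
  have hi : ⟪a, b⟫_ℝ = a 0 * b 0 + a 1 * b 1 + a 2 * b 2 := by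
    simp only [PiLp.inner_apply, Fin.sum_univ_three, RCLike.inner_apply, conj_trivial]
    ring
  have hn0 : a 0 ^ 2 + a 1 ^ 2 + a 2 ^ 2 ≠ 0 := by
    rw [← hn]; exact pow_ne_zero 2 (norm_ne_zero_iff.2 ha)
  rw [hn, hi]
  ext i
  fin_cases i
  · simp only [cross, cross_apply, PiLp.add_apply, PiLp.smul_apply, smul_eq_mul,
      WithLp.ofLp_smul, Pi.smul_apply, Matrix.cons_val_zero, Matrix.cons_val_one,
      Matrix.cons_val_two, Matrix.head_cons, Matrix.tail_cons, Fin.isValue, Fin.zero_eta]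
    field_simp
    ring
  · simp only [cross, cross_apply, PiLp.add_apply, PiLp.smul_apply, smul_eq_mul,
      WithLp.ofLp_smul, Pi.smul_apply, Matrix.cons_val_zero, Matrix.cons_val_one,
      Matrix.cons_val_two, Matrix.head_cons, Matrix.tail_cons, Fin.isValue, Fin.mk_one]
    field_simp
    ring
  · simp only [cross, cross_apply, PiLp.add_apply, PiLp.smul_apply, smul_eq_mul,
      WithLp.ofLp_smul, Pi.smul_apply, Matrix.cons_val_zero, Matrix.cons_val_one,
      Matrix.cons_val_two, Matrix.head_cons, Matrix.tail_cons, Fin.isValue, Fin.reduceFinMk]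
    field_simp
    ring

/-- `det R · det R = 1` for a linear isometry of `ℝ³`. -/
theorem det_mul_det_eq_one (R : EuclideanSpace ℝ (Fin 3) ≃ₗᵢ[ℝ] EuclideanSpace ℝ (Fin 3)) :
    (R : EuclideanSpace ℝ (Fin 3) →L[ℝ] EuclideanSpace ℝ (Fin 3)).det *
      (R : EuclideanSpace ℝ (Fin 3) →L[ℝ] EuclideanSpace ℝ (Fin 3)).det = 1 := by
  rcases det_linearIsometryEquiv_eq_one_or_eq_neg_one R with h | h <;> rw [h] <;> norm_num

/-! ### The Killing branch of TSG: any axis, any pitch -/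

/-- **Infinitesimal Killing symmetry of the vorticity on an open set of ONE slice kills the door-class profile.**
If `(a,b) ≠ (0,0)` and `D(curl v(s))(y)[a × (y − c) + b] = a × curl v(s)(y)` for `y` in a nonempty open `U`, then
`v ≡ 0`.  Branches: `a = 0` (translation germ, `…LocalVorticitySymmetry`); `a ≠ 0`: normal form `b = a × d + κa`,
conjugation to the vertical axis through the origin by a linear isometry `L` with `L⁻¹e₃ = a/‖a‖` composed with the
translation by `c − d`; `κ = 0` rotation germ (`eq_zero_of_curl_isAxisymmetric_slice_of_cylBound`); `κ ≠ 0` screw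
germ: the integrated symmetry at one full turn is a vertical period of the vorticity, hence of the velocity slice
(`periodic_of_curl_periodic`), which decays at infinity and so vanishes; a zero slice is translation-invariant and
`eq_zero_of_translate_eq_slice` ends. -/
theorem eq_zero_of_killingGerm_slice (hrate : HasTypeITimeDecay C v) (hdec : HasTypeIDecay D v)
    (hcont : ContinuousOn (uncurry v) (Iio (0 : ℝ) ×ˢ univ))
    (hmild : ∀ s t : ℝ, s < t → t < 0 → ∀ x,
      v t x = UnboundedOperators.heatExtension (v s) (t - s) x - oseenDuhamel 1 s v v t x)
    (hdiv : ∀ t < 0, VectorCalculus.IsDivFree (v t)) {s : ℝ} (hs : s < 0)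
    {U : Set (EuclideanSpace ℝ (Fin 3))} (hU : IsOpen U) (hne : U.Nonempty) {a b c : EuclideanSpace ℝ (Fin 3)}
    (hab : a ≠ 0 ∨ b ≠ 0)
    (hK : ∀ y ∈ U, fderiv ℝ (curl (v s)) y (cross a (y - c) + b) = cross a (curl (v s) y)) :
    ∀ t < 0, ∀ x, v t x = 0 := by
  by_cases ha : a = 0
  · -- ### translation germ
    have hb : b ≠ 0 := by
      rcases hab with h | h
      · exact absurd ha h
      · exact h
    have h0 : ∀ w : EuclideanSpace ℝ (Fin 3), cross (0 : EuclideanSpace ℝ (Fin 3)) w = 0 := fun w => by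
      rw [← crossCLM_apply, map_zero]
      rfl
    have hK' : ∀ y ∈ U, fderiv ℝ (curl (v s)) y b = 0 := fun y hy => by
      have h := hK y hy
      rwa [ha, h0, h0, zero_add] at h
    exact eq_zero_of_curl_translate_eq_slice hrate hcont hmild hdiv hs hb
      (curl_translate_of_fderiv_eq_zero_on hrate hcont hmild hs hU hne hK')
  -- ### rotation / screw germ about the axis through `c' = c − d` with direction `a`
  set α : ℝ := ‖a‖ with hα
  have hα0 : 0 < α := norm_pos_iff.2 ha
  have hα2 : α ^ 2 ≠ 0 := pow_ne_zero 2 hα0.ne'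
  set κ : ℝ := ⟪a, b⟫_ℝ / α ^ 2 with hκ
  set d : EuclideanSpace ℝ (Fin 3) := (α ^ 2)⁻¹ • cross b a with hd
  set c' : EuclideanSpace ℝ (Fin 3) := c - d with hc'
  have hdecomp : ∀ y : EuclideanSpace ℝ (Fin 3), cross a (y - c) + b = cross a (y - c') + κ • a := by
    intro y
    have h1 : cross a d + κ • a = b := cross_decomposition ha b
    rw [hc', show y - (c - d) = (y - c) + d by abel, cross_add_right, add_assoc, h1]
  -- the isometry `L` with `L⁻¹ e₃ = a/α`, so `L a = α e₃`
  obtain ⟨L, hL⟩ := exists_linearIsometryEquiv_symm_single_two ha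
  rw [← hα] at hL
  set e₃ : EuclideanSpace ℝ (Fin 3) := EuclideanSpace.single 2 (1 : ℝ) with he₃
  set ε : ℝ := (L : EuclideanSpace ℝ (Fin 3) →L[ℝ] EuclideanSpace ℝ (Fin 3)).det with hε
  have hε2 : ε * ε = 1 := det_mul_det_eq_one L
  have hLa : L a = α • e₃ := by
    have h1 : a = α • L.symm e₃ := by
      rw [hL, smul_smul, mul_inv_cancel₀ hα0.ne', one_smul]
    rw [h1, LinearIsometryEquiv.map_smul, LinearIsometryEquiv.apply_symm_apply]
  -- ### the profile in the frame of the axis: `w(t,x) = L v(t, L⁻¹x + c')`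
  obtain ⟨hrate₁, hcont₁, hmild₁, hdiv₁⟩ := class_translate c' hrate hcont hmild hdiv
  obtain ⟨hrate', hcont', hmild', hdiv'⟩ := class_conj_linearIsometryEquiv L hrate₁ hcont₁ hmild₁ hdiv₁
  set w : ℝ → EuclideanSpace ℝ (Fin 3) → EuclideanSpace ℝ (Fin 3) :=
    fun t x => L ((fun t y => v t (y + c')) t (L.symm x)) with hw
  have hw_apply : ∀ t x, w t x = L (v t (L.symm x + c')) := fun t x => rfl
  -- it suffices to show `w ≡ 0`
  suffices hzero : ∀ t < 0, ∀ x, w t x = 0 by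
    intro t ht x
    have h := hzero t ht (L (x - c'))
    rw [hw_apply, LinearIsometryEquiv.symm_apply_apply, sub_add_cancel, LinearIsometryEquiv.map_eq_zero_iff] at h
    exact h
  have hbddw := bdd_of_hasTypeITimeDecay hrate'
  have hboundw : ∀ δ : ℝ, 0 < δ → ∃ C' : ℝ, ∀ t < -δ, ∀ y : EuclideanSpace ℝ (Fin 3),
      cylRadius y * ‖w t y‖ ≤ C' := cylBound_conj_translate hrate hdec L c'
  -- ### vorticities: `ω = curl v(s)`, `ω_w = curl w(s) = ε · L ω(L⁻¹x + c')`
  have hAv : AnalyticOnNhd ℝ (v s) univ := analyticOnNhd_slice hcont (bdd_of_hasTypeITimeDecay hrate) hmild hs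
  have hω : AnalyticOnNhd ℝ (curl (v s)) univ := analyticOnNhd_curl hAv
  have hωd : Differentiable ℝ (curl (v s)) := fun y => (hω y (mem_univ y)).differentiableAt
  have hAw : AnalyticOnNhd ℝ (w s) univ := analyticOnNhd_slice hcont' hbddw hmild' hs
  have hωw : AnalyticOnNhd ℝ (curl (w s)) univ := analyticOnNhd_curl hAw
  have hωwd : Differentiable ℝ (curl (w s)) := fun y => (hωw y (mem_univ y)).differentiableAt
  set ψ : EuclideanSpace ℝ (Fin 3) → EuclideanSpace ℝ (Fin 3) := fun x => L.symm x + c' with hψ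
  have hcurlw : ∀ x, curl (w s) x = ε • L (curl (v s) (ψ x)) := by
    intro x
    have h1 := curl_conj_linearIsometryEquiv L (fun y => v s (y + c')) x
    rw [curl_comp_add_const (v s) c' (L.symm x)] at h1
    exact h1
  have hcurlw_fun : curl (w s) = fun x => ε • L (curl (v s) (ψ x)) := funext hcurlw
  -- derivative of `ω_w`
  have hDw : ∀ x h, fderiv ℝ (curl (w s)) x h = ε • L (fderiv ℝ (curl (v s)) (ψ x) (L.symm h)) := by
    intro x h
    have h1 : HasFDerivAt ψ (L.symm : EuclideanSpace ℝ (Fin 3) →L[ℝ] EuclideanSpace ℝ (Fin 3)) x :=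
      ((L.symm : EuclideanSpace ℝ (Fin 3) →L[ℝ] EuclideanSpace ℝ (Fin 3)).hasFDerivAt).add_const c'
    have h2 : HasFDerivAt (curl (v s)) (fderiv ℝ (curl (v s)) (ψ x)) (ψ x) := (hωd _).hasFDerivAt
    have h3 := h2.comp x h1
    have h4 := ((L : EuclideanSpace ℝ (Fin 3) →L[ℝ] EuclideanSpace ℝ (Fin 3)).hasFDerivAt).comp x h3
    have h5 := h4.const_smul ε
    have h6 : HasFDerivAt (curl (w s))
        (ε • ((L : EuclideanSpace ℝ (Fin 3) →L[ℝ] EuclideanSpace ℝ (Fin 3)).comp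
          ((fderiv ℝ (curl (v s)) (ψ x)).comp
            (L.symm : EuclideanSpace ℝ (Fin 3) →L[ℝ] EuclideanSpace ℝ (Fin 3))))) x := by
      rw [hcurlw_fun]
      exact h5
    rw [h6.fderiv]
    rfl
  -- ### the Killing identity in the new frame: a vertical screw of pitch `ε κ`
  set U' : Set (EuclideanSpace ℝ (Fin 3)) := ψ ⁻¹' U with hU'
  have hψc : Continuous ψ := L.symm.continuous.add continuous_const
  have hU'o : IsOpen U' := hU.preimage hψc
  have hU'ne : U'.Nonempty := by
    obtain ⟨y₀, hy₀⟩ := hne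
    refine ⟨L (y₀ - c'), ?_⟩
    show ψ (L (y₀ - c')) ∈ U
    rw [hψ]
    simpa using hy₀
  have hKw : ∀ x ∈ U', fderiv ℝ (curl (w s)) x ((ε * κ) • e₃ + rotGen x) = rotGen (curl (w s) x) := by
    intro x hx
    have hyU : ψ x ∈ U := hx
    -- `L⁻¹ (εκ e₃ + J x) = (ε/α) (a × (ψ x − c') + κ a)`
    have hJ : L.symm (rotGen x) = (ε / α) • cross a (ψ x - c') := by
      rw [rotGen_eq_cross, symm_cross_eq, hL, cross_smul_left, smul_smul]
      have e : ψ x - c' = L.symm x := by rw [hψ]; simp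
      rw [e, div_eq_mul_inv]
    have harg : L.symm ((ε * κ) • e₃ + rotGen x) = (ε / α) • (cross a (ψ x - c') + κ • a) := by
      rw [map_add, LinearIsometryEquiv.map_smul, hL, hJ, smul_add, smul_smul, smul_smul, add_comm]
      congr 2
      ring
    rw [hDw, harg, map_smul, ← hdecomp (ψ x), hK (ψ x) hyU, map_smul]
    -- `L (a × ω(ψ x)) = ε α · J (L ω(ψ x))`
    have hcr : L (cross a (curl (v s) (ψ x))) = (ε * α) • rotGen (L (curl (v s) (ψ x))) := by
      have h1 := cross_map_linearIsometryEquiv L a (curl (v s) (ψ x))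
      rw [hLa, cross_smul_left, ← rotGen_eq_cross, ← hε] at h1
      -- `h1 : α • J(L ω) = ε • L (a × ω)`; multiply by `ε` and use `ε² = 1`
      calc L (cross a (curl (v s) (ψ x)))
          = (ε * ε) • L (cross a (curl (v s) (ψ x))) := by rw [hε2, one_smul]
        _ = ε • (ε • L (cross a (curl (v s) (ψ x)))) := by rw [smul_smul]
        _ = ε • (α • rotGen (L (curl (v s) (ψ x)))) := by rw [← h1]
        _ = (ε * α) • rotGen (L (curl (v s) (ψ x))) := by rw [smul_smul]
    have hR : rotGen (curl (w s) x) = ε • rotGen (L (curl (v s) (ψ x))) := by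
      rw [hcurlw x, rotGen_smul]
    rw [hR, hcr, smul_smul, smul_smul]
    congr 1
    rw [show ε * (ε / α) * (ε * α) = (ε * ε) * ε * (α⁻¹ * α) by ring, hε2, inv_mul_cancel₀ hα0.ne', one_mul,
      mul_one]
  -- the identity holds everywhere (analyticity)
  have hKw_all : ∀ x, fderiv ℝ (curl (w s)) x ((ε * κ) • e₃ + rotGen x) = rotGen (curl (w s) x) := by
    have hf : AnalyticOnNhd ℝ (fun x => fderiv ℝ (curl (w s)) x ((ε * κ) • e₃ + rotGen x)) univ :=
      analyticOnNhd_fderiv_apply hωw (analyticOnNhd_const.add analyticOnNhd_rotGen)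
    have hg : AnalyticOnNhd ℝ (fun x => rotGen (curl (w s) x)) univ := fun x _ =>
      ((rotGenL.analyticAt (curl (w s) x)).comp (hωw x (mem_univ x))).congr
        (Eventually.of_forall fun z => rotGenL_apply _)
    exact eq_of_eqOn_open hf hg hU'o hU'ne hKw
  by_cases hκ0 : κ = 0
  · -- ### rotation germ: `ω_w` is axisymmetric about the vertical axis
    have hrot : ∀ x, rotGen (curl (w s) x) = fderiv ℝ (curl (w s)) x (rotGen x) := fun x => by
      have h := hKw_all x
      rw [hκ0, mul_zero, zero_smul, zero_add] at h
      exact h.symm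
    have hax : IsAxisymmetric (curl (w s)) := isAxisymmetric_of_rotDefect_eq_zero hωw.contDiff hrot
    exact eq_zero_of_curl_isAxisymmetric_slice_of_cylBound hrate' hcont' hmild' hdiv' hboundw hs hax
  · -- ### screw germ: one full turn is a vertical translation by `2π ε κ`
    have hscrew := screw_equivariant hωwd (ε * κ) (fun y => by
      rw [show (ε * κ) • ez + rotGen y = (ε * κ) • e₃ + rotGen y from rfl]
      exact hKw_all y)
    set p : EuclideanSpace ℝ (Fin 3) := (2 * Real.pi * (ε * κ)) • e₃ with hp
    have hεne : ε ≠ 0 := fun h0 => by rw [h0, mul_zero] at hε2; exact zero_ne_one hε2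
    have hpne : p ≠ 0 := by
      rw [hp]
      refine smul_ne_zero (mul_ne_zero (mul_ne_zero two_ne_zero Real.pi_ne_zero) (mul_ne_zero hεne hκ0)) ?_
      intro h0
      simpa [he₃] using congrArg (fun w : EuclideanSpace ℝ (Fin 3) => w 2) h0
    have hper_curl : ∀ x, curl (w s) (x + p) = curl (w s) x := by
      intro x
      have h := hscrew (2 * Real.pi) x
      rw [rotZ_two_pi, rotZ_two_pi] at h
      rw [hp]
      exact h
    -- the velocity slice is periodic too, and decays at infinity: it vanishes
    have hV2 : ContDiff ℝ 2 (w s) := hAw.contDiff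
    have hper : ∀ x, w s (x + p) = w s x :=
      periodic_of_curl_periodic hV2 (hdiv' s hs) (fun x => hrate' s hs x) hper_curl
    have hsmall : ∀ ε' : ℝ, 0 < ε' → ∃ R : ℝ, ∀ x, R ≤ ‖x‖ → ‖w s x‖ < ε' := fun ε' hε' => by
      obtain ⟨R, hR⟩ := eventually_norm_conj_translate_lt hdec L c' hs hε'
      exact ⟨R, fun x hx => by rw [hw_apply]; exact hR x hx⟩
    have hslice : ∀ x, w s x = 0 := eq_zero_of_periodic_of_small_at_infinity hpne hper hsmall
    have hinv : ∀ (y : EuclideanSpace ℝ (Fin 3)) (l : ℝ), w s (y + l • p) = w s y := fun y l => by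
      rw [hslice, hslice]
    exact eq_zero_of_translate_eq_slice hrate' hcont' hmild' hdiv' hs hpne hinv

/-! ### `stub_symmetricGermsRegular` -/

/-- **`ScrewVorticityGermRegular` (the named residual of nsreg-p1's LINE 2 v2/v3, `r18/TiltingSymmetryGerm_line_v3.lean`
l.745, text verbatim), PROVED**: a door-class profile whose vorticity carries, on a nonempty open subset of SOME slice,
an infinitesimal rotation/screw symmetry `D(curl v(s))(y)[a × (y − c) + b] = a × curl v(s)(y)` with `a ≠ 0`, is not
backward-singular (`eq_zero_of_killingGerm_slice`).  The planner proved the same statement independently in its work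
folder (`r18/ScrewVorticityGermRegular.lean`, ROUND-18 Addendum B); this is the tree landing. -/
theorem screwVorticityGermRegular : ∀ (C D : ℝ) (v : ℝ → EuclideanSpace ℝ (Fin 3) → EuclideanSpace ℝ (Fin 3)), Literature.Analysis.FluidPDE.HasTypeITimeDecay C v → Literature.Analysis.FluidPDE.HasTypeIDecay D v → ContinuousOn (Function.uncurry v) (Set.Iio (0 : ℝ) ×ˢ Set.univ) → (∀ s t : ℝ, s < t → t < 0 → ∀ x, v t x = Literature.Analysis.UnboundedOperators.heatExtension (v s) (t - s) x - Literature.Analysis.FluidPDE.oseenDuhamel 1 s v v t x) → (∀ t < 0, Literature.Analysis.FluidPDE.VectorCalculus.IsDivFree (v t)) → (∃ s : ℝ, s < 0 ∧ ∃ U : Set (EuclideanSpace ℝ (Fin 3)), IsOpen U ∧ U.Nonempty ∧ ∃ a b c : EuclideanSpace ℝ (Fin 3), a ≠ 0 ∧ ∀ y ∈ U, (fderiv ℝ (Literature.Analysis.FluidPDE.curl (v s)) y (Literature.Analysis.FluidPDE.cross a (y - c) + b) = Literature.Analysis.FluidPDE.cross a (Literature.Analysis.FluidPDE.curl (v s)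 y))) → ¬ Literature.Analysis.FluidPDE.IsBackwardSingularPoint v 0 := by
  intro C D v hrate hdec hcont hmild hdiv hgerm
  obtain ⟨s, hs, U, hU, hne, a, b, c, ha, hK⟩ := hgerm
  exact not_backwardSingular_of_zero (eq_zero_of_killingGerm_slice hrate hdec hcont hmild hdiv hs hU hne (Or.inl ha) hK)


/-- **`stub_symmetricGermsRegular` of LINE 2 (text of nsreg-p1 `r18/TiltingSymmetryGerm_line.lean`, verbatim), PROVED**:
a door-class profile such that on every slice, inside every window where the vorticity does not vanish, some sub-window
carries an infinitesimal Euclidean Killing symmetry of the vorticity OR agreement of the velocity with an entire field of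
unbounded norm, is not backward-singular at the apex.  Proof on the slice `s = −1`: an irrotational slice kills the
profile (`eq_zero_of_curl_eq_zero_on_open`); otherwise the window `{curl v(−1) ≠ 0}` is nonempty open, the Killing
branch is `eq_zero_of_killingGerm_slice`, and the entire branch is empty (`not_slice_eqOn_open_of_not_bddAbove`). -/
theorem symmetricGermsRegular : ∀ (C D : ℝ) (v : ℝ → EuclideanSpace ℝ (Fin 3) → EuclideanSpace ℝ (Fin 3)), Literature.Analysis.FluidPDE.HasTypeITimeDecay C v → Literature.Analysis.FluidPDE.HasTypeIDecay D v → ContinuousOn (Function.uncurry v) (Set.Iio (0 : ℝ) ×ˢ Set.univ) → (∀ s t : ℝ, s < t → t < 0 → ∀ x, v t x = Literature.Analysis.UnboundedOperators.heatExtension (v s) (t - s) x - Literature.Analysis.FluidPDE.oseenDuhamel 1 s v v t x) → (∀ t < 0, Literature.Analysis.FluidPDE.VectorCalculus.IsDivFree (v t)) → (∀ s < 0, ∀ W : Set (EuclideanSpace ℝ (Fin 3)), IsOpen W → W.Nonempty → (∀ y ∈ W, Literature.Analysis.FluidPDE.curl (v s) y ≠ 0) → ∃ U : Set (EuclideanSpace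 ℝ (Fin 3)), IsOpen U ∧ U.Nonempty ∧ U ⊆ W ∧ ((∃ a b c : EuclideanSpace ℝ (Fin 3), (a ≠ 0 ∨ b ≠ 0) ∧ ∀ y ∈ U, (fderiv ℝ (Literature.Analysis.FluidPDE.curl (v s)) y (Literature.Analysis.FluidPDE.cross a (y - c) + b) = Literature.Analysis.FluidPDE.cross a (Literature.Analysis.FluidPDE.curl (v s) y))) ∨ (∃ w : EuclideanSpace ℝ (Fin 3) → EuclideanSpace ℝ (Fin 3), AnalyticOnNhd ℝ w Set.univ ∧ ¬ BddAbove (Set.range fun y => ‖w y‖) ∧ ∀ y ∈ U, v s y = w y))) → ¬ Literature.Analysis.FluidPDE.IsBackwardSingularPoint v 0 := by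
  intro C D v hrate hdec hcont hmild hdiv hgerm
  have hs : (-1 : ℝ) < 0 := by norm_num
  by_cases hzero : ∀ y, curl (v (-1)) y = 0
  · exact not_backwardSingular_of_zero
      (eq_zero_of_curl_eq_zero_on_open hrate hcont hmild hdiv hs isOpen_univ univ_nonempty fun y _ => hzero y)
  · push Not at hzero
    obtain ⟨y₀, hy₀⟩ := hzero
    have hcW : Continuous (curl (v (-1))) := by
      rw [← continuousOn_univ]
      exact (analyticOnNhd_curl_slice hrate hcont hmild hs).continuousOn
    have hWo : IsOpen {y : EuclideanSpace ℝ (Fin 3) | curl (v (-1)) y ≠ 0} := isOpen_ne_fun hcW continuous_const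
    obtain ⟨U, hU, hUne, -, hbranch⟩ := hgerm (-1) hs {y | curl (v (-1)) y ≠ 0} hWo ⟨y₀, hy₀⟩ (fun y hy => hy)
    rcases hbranch with ⟨a, b, c, hab, hK⟩ | ⟨w, hw, hunb, heq⟩
    · exact not_backwardSingular_of_zero (eq_zero_of_killingGerm_slice hrate hdec hcont hmild hdiv hs hU hUne hab hK)
    · exact absurd heq (not_slice_eqOn_open_of_not_bddAbove hrate hcont hmild hs hw hunb hU hUne)

/-! ### LINE 2 and the door, closed modulo the hard stub TSG (by name) -/

/-- **LINE 2 closed modulo its hard stub, by name**: the text of K2 `TiltingFreeProfileRigidity` (nsreg-p1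
`r18/Sketch19.lean`) follows from the text of `stub_tiltingSymmetryGerm` («TSG») alone — the tree's
`…LocalTiltingFreeDoorDirectionLine.tiltingWindowToSlab` feeds it and `symmetricGermsRegular` finishes (the planner's
composition `TiltingFreeProfileRigidity_of_local` with both M-stubs discharged). -/
theorem tiltingFreeProfileRigidity_of_tiltingSymmetryGerm
    (hTSG : ∀ (C D : ℝ) (v : ℝ → EuclideanSpace ℝ (Fin 3) → EuclideanSpace ℝ (Fin 3)), Literature.Analysis.FluidPDE.HasTypeITimeDecay C v → Literature.Analysis.FluidPDE.HasTypeIDecay D v → ContinuousOn (Function.uncurry v) (Set.Iio (0 : ℝ) ×ˢ Set.univ) → (∀ s t : ℝ, s < t → t < 0 → ∀ x, v t x = Literature.Analysis.UnboundedOperators.heatExtension (v s) (t - s) x - Literature.Analysis.FluidPDE.oseenDuhamel 1 s v v t x) → (∀ t < 0, Literature.Analysis.FluidPDE.VectorCalculus.IsDivFree (v t)) → (∀ s < 0, ∀ z : EuclideanSpace ℝ (Fin 3), Literature.Analysis.FluidPDE.cross (Literature.Analysis.FluidPDE.curlCLM (fderiv ℝ (v s) z)) ((fderiv ℝ (v s)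 z) (Literature.Analysis.FluidPDE.curlCLM (fderiv ℝ (v s) z))) = 0) → (∀ s < 0, ∀ W : Set (EuclideanSpace ℝ (Fin 3)), IsOpen W → W.Nonempty → (∀ y ∈ W, Literature.Analysis.FluidPDE.curl (v s) y ≠ 0) → ∃ U : Set (EuclideanSpace ℝ (Fin 3)), IsOpen U ∧ U.Nonempty ∧ U ⊆ W ∧ ((∃ a b c : EuclideanSpace ℝ (Fin 3), (a ≠ 0 ∨ b ≠ 0) ∧ ∀ y ∈ U, (fderiv ℝ (Literature.Analysis.FluidPDE.curl (v s)) y (Literature.Analysis.FluidPDE.cross a (y - c) + b) = Literature.Analysis.FluidPDE.cross a (Literature.Analysis.FluidPDE.curl (v s) y))) ∨ (∃ w : EuclideanSpace ℝ (Fin 3) → EuclideanSpace ℝ (Fin 3), AnalyticOnNhd ℝ w Set.univ ∧ ¬ BddAbove (Set.range fun y => ‖w y‖) ∧ ∀ y ∈ U, v s y = w y)))) :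
    ∀ (C D : ℝ) (v : ℝ → EuclideanSpace ℝ (Fin 3) → EuclideanSpace ℝ (Fin 3)), Literature.Analysis.FluidPDE.HasTypeITimeDecay C v → Literature.Analysis.FluidPDE.HasTypeIDecay D v → ContinuousOn (Function.uncurry v) (Set.Iio (0 : ℝ) ×ˢ Set.univ) → (∀ s t : ℝ, s < t → t < 0 → ∀ x, v t x = Literature.Analysis.UnboundedOperators.heatExtension (v s) (t - s) x - Literature.Analysis.FluidPDE.oseenDuhamel 1 s v v t x) → (∀ t < 0, Literature.Analysis.FluidPDE.VectorCalculus.IsDivFree (v t)) → (∀ s < 0, ∃ U : Set (EuclideanSpace ℝ (Fin 3)), IsOpen U ∧ U.Nonempty ∧ ∀ z ∈ U, Literature.Analysis.FluidPDE.cross (Literature.Analysis.FluidPDE.curlCLM (fderiv ℝ (v s) z)) ((fderiv ℝ (v s) z) (Literature.Analysis.FluidPDE.curlCLM (fderiv ℝ (v s) z))) = 0) → ¬ Literature.Analysis.FluidPDE.IsBackwardSingularPoint v 0 := by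
  intro C D v hrate hdecay hcont hmild hdiv hwin
  exact symmetricGermsRegular C D v hrate hdecay hcont hmild hdiv
    (hTSG C D v hrate hdecay hcont hmild hdiv
      (Summit.NavierStokesRegularity.NavierStokesRegularity.Theorems.LocalTiltingFreeDoorDirectionLine.tiltingWindowToSlab
        C D v hrate hdecay hcont hmild hdiv hwin))

/-- **DOOR S19 modulo TSG**: the text of `Target` of nsreg-p1 `r18/Sketch19.lean` (local space–time Type I at `(x₀,T)` +
scale-normalised vortex tilting fading in `L¹` on ONE similarity window ⇒ backward bounded) follows from the text of the
single hard stub `stub_tiltingSymmetryGerm` (tree `…LocalTiltingFreeDoorTarget.target_of_tiltingFreeProfileRigidity` ∘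
`tiltingFreeProfileRigidity_of_tiltingSymmetryGerm`). -/
theorem target_of_tiltingSymmetryGerm
    (hTSG : ∀ (C D : ℝ) (v : ℝ → EuclideanSpace ℝ (Fin 3) → EuclideanSpace ℝ (Fin 3)), Literature.Analysis.FluidPDE.HasTypeITimeDecay C v → Literature.Analysis.FluidPDE.HasTypeIDecay D v → ContinuousOn (Function.uncurry v) (Set.Iio (0 : ℝ) ×ˢ Set.univ) → (∀ s t : ℝ, s < t → t < 0 → ∀ x, v t x = Literature.Analysis.UnboundedOperators.heatExtension (v s) (t - s) x - Literature.Analysis.FluidPDE.oseenDuhamel 1 s v v t x) → (∀ t < 0, Literature.Analysis.FluidPDE.VectorCalculus.IsDivFree (v t)) → (∀ s < 0, ∀ z : EuclideanSpace ℝ (Fin 3), Literature.Analysis.FluidPDE.cross (Literature.Analysis.FluidPDE.curlCLM (fderiv ℝ (v s) z)) ((fderiv ℝ (v s) z) (Literature.Analysis.FluidPDE.curlCLM (fderiv ℝ (v s) z))) = 0) → (∀ s < 0, ∀ W : Set (EuclideanSpace ℝ (Fin 3)), IsOpen W → W.Nonempty → (∀ y ∈ W, Literature.Analysis.FluidPDE.curl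 (v s) y ≠ 0) → ∃ U : Set (EuclideanSpace ℝ (Fin 3)), IsOpen U ∧ U.Nonempty ∧ U ⊆ W ∧ ((∃ a b c : EuclideanSpace ℝ (Fin 3), (a ≠ 0 ∨ b ≠ 0) ∧ ∀ y ∈ U, (fderiv ℝ (Literature.Analysis.FluidPDE.curl (v s)) y (Literature.Analysis.FluidPDE.cross a (y - c) + b) = Literature.Analysis.FluidPDE.cross a (Literature.Analysis.FluidPDE.curl (v s) y))) ∨ (∃ w : EuclideanSpace ℝ (Fin 3) → EuclideanSpace ℝ (Fin 3), AnalyticOnNhd ℝ w Set.univ ∧ ¬ BddAbove (Set.range fun y => ‖w y‖) ∧ ∀ y ∈ U, v s y = w y)))) :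
    ∀ (ν T : ℝ), 0 < ν → 0 < T → ∀ (u : ℝ → EuclideanSpace ℝ (Fin 3) → EuclideanSpace ℝ (Fin 3)) (p : ℝ → EuclideanSpace ℝ (Fin 3) → ℝ), Literature.Analysis.FluidPDE.IsClassicalNSSolutionOn (Set.Ico 0 T) ν 0 u p → Literature.Analysis.FluidPDE.IsLerayHopfOn T ν 0 (u 0) u → Literature.Analysis.FluidPDE.HasRapidSpatialDecay (u 0) → ∀ (x₀ : EuclideanSpace ℝ (Fin 3)) (ρ M : ℝ), 0 < ρ → (∀ t ∈ Set.Ico 0 T, T - ρ ^ 2 < t → ∀ x ∈ Metric.ball x₀ ρ, ‖u t x‖ * (‖x - x₀‖ + Real.sqrt (ν * (T - t))) ≤ M) → ∀ (U : Set (EuclideanSpace ℝ (Fin 3))), IsOpen U → U.Nonempty → Filter.Tendsto (fun t => ∫⁻ y in U, ENNReal.ofReal ‖Literature.Analysis.FluidPDE.cross (Literature.Analysis.FluidPDE.curlCLM (Real.sqrt (T - t) ^ 2 • fderiv ℝ (u t) (x₀ + Real.sqrt (T - t) • y))) ((Real.sqrt (T - t) ^ 2 • fderiv ℝ (u t) (x₀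 + Real.sqrt (T - t) • y)) (Literature.Analysis.FluidPDE.curlCLM (Real.sqrt (T - t) ^ 2 • fderiv ℝ (u t) (x₀ + Real.sqrt (T - t) • y))))‖) (nhdsWithin T (Set.Iio T)) (nhds 0) → Literature.Analysis.FluidPDE.IsBackwardBoundedAt u T x₀ :=
  Summit.NavierStokesRegularity.NavierStokesRegularity.Theorems.LocalTiltingFreeDoorTarget.target_of_tiltingFreeProfileRigidity
    (tiltingFreeProfileRigidity_of_tiltingSymmetryGerm hTSG)

/-- **DOOR S19 modulo the LINE-1 hard stub**: the text of `Target` follows from the text of `stub_directionRigidity`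
(tree `…LocalTiltingFreeDoorTarget.target_of_tiltingFreeProfileRigidity` ∘
`…LocalTiltingFreeDoorDirectionLine.tiltingFreeProfileRigidity_of_directionRigidity`). -/
theorem target_of_directionRigidity
    (hdir : ∀ (C D : ℝ) (v : ℝ → EuclideanSpace ℝ (Fin 3) → EuclideanSpace ℝ (Fin 3)), Literature.Analysis.FluidPDE.HasTypeITimeDecay C v → Literature.Analysis.FluidPDE.HasTypeIDecay D v → ContinuousOn (Function.uncurry v) (Set.Iio (0 : ℝ) ×ˢ Set.univ) → (∀ s t : ℝ, s < t → t < 0 → ∀ x, v t x = Literature.Analysis.UnboundedOperators.heatExtension (v s) (t - s) x - Literature.Analysis.FluidPDE.oseenDuhamel 1 s v v t x) → (∀ t < 0, Literature.Analysis.FluidPDE.VectorCalculus.IsDivFree (v t)) → (∀ s < 0, ∀ z : EuclideanSpace ℝ (Fin 3), Literature.Analysis.FluidPDE.cross (Literature.Analysis.FluidPDE.curlCLM (fderiv ℝ (v s) z)) ((fderiv ℝ (v s) z) (Literature.Analysis.FluidPDE.curlCLM (fderiv ℝ (v s) z))) = 0) → (∃ e : EuclideanSpace ℝ (Fin 3),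 e ≠ 0 ∧ ∀ s < 0, ∀ z : EuclideanSpace ℝ (Fin 3), Literature.Analysis.FluidPDE.cross e (Literature.Analysis.FluidPDE.curlCLM (fderiv ℝ (v s) z)) = 0)) :
    ∀ (ν T : ℝ), 0 < ν → 0 < T → ∀ (u : ℝ → EuclideanSpace ℝ (Fin 3) → EuclideanSpace ℝ (Fin 3)) (p : ℝ → EuclideanSpace ℝ (Fin 3) → ℝ), Literature.Analysis.FluidPDE.IsClassicalNSSolutionOn (Set.Ico 0 T) ν 0 u p → Literature.Analysis.FluidPDE.IsLerayHopfOn T ν 0 (u 0) u → Literature.Analysis.FluidPDE.HasRapidSpatialDecay (u 0) → ∀ (x₀ : EuclideanSpace ℝ (Fin 3)) (ρ M : ℝ), 0 < ρ → (∀ t ∈ Set.Ico 0 T, T - ρ ^ 2 < t → ∀ x ∈ Metric.ball x₀ ρ, ‖u t x‖ * (‖x - x₀‖ + Real.sqrt (ν * (T - t))) ≤ M) → ∀ (U : Set (EuclideanSpace ℝ (Fin 3))), IsOpen U → U.Nonempty → Filter.Tendsto (fun t => ∫⁻ y in U, ENNReal.ofReal ‖Literature.Analysis.FluidPDE.cross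 (Literature.Analysis.FluidPDE.curlCLM (Real.sqrt (T - t) ^ 2 • fderiv ℝ (u t) (x₀ + Real.sqrt (T - t) • y))) ((Real.sqrt (T - t) ^ 2 • fderiv ℝ (u t) (x₀ + Real.sqrt (T - t) • y)) (Literature.Analysis.FluidPDE.curlCLM (Real.sqrt (T - t) ^ 2 • fderiv ℝ (u t) (x₀ + Real.sqrt (T - t) • y))))‖) (nhdsWithin T (Set.Iio T)) (nhds 0) → Literature.Analysis.FluidPDE.IsBackwardBoundedAt u T x₀ :=
  Summit.NavierStokesRegularity.NavierStokesRegularity.Theorems.LocalTiltingFreeDoorTarget.target_of_tiltingFreeProfileRigidity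
    (Summit.NavierStokesRegularity.NavierStokesRegularity.Theorems.LocalTiltingFreeDoorDirectionLine.tiltingFreeProfileRigidity_of_directionRigidity
      hdir)

/-- **LINE 1, weakest honest form of its hard stub** (ROUND-18 §1(E): «SOME slice is unidirectional suffices»): K2
`TiltingFreeProfileRigidity` (text verbatim) follows from «an everywhere tilting-free door-class profile has, on SOME
slice `s < 0`, vorticity everywhere parallel to SOME fixed `e ≠ 0`» — by the tree's one-slice theorem
`…LocalTiltingFreeDoorDirectionLine.eq_zero_of_curl_parallel_slice`.  A candidate RESHAPE of `stub_directionRigidity`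
for the planner (not a registered text). -/
theorem tiltingFreeProfileRigidity_of_directionRigiditySlice
    (hdir : ∀ (C D : ℝ) (v : ℝ → EuclideanSpace ℝ (Fin 3) → EuclideanSpace ℝ (Fin 3)), Literature.Analysis.FluidPDE.HasTypeITimeDecay C v → Literature.Analysis.FluidPDE.HasTypeIDecay D v → ContinuousOn (Function.uncurry v) (Set.Iio (0 : ℝ) ×ˢ Set.univ) → (∀ s t : ℝ, s < t → t < 0 → ∀ x, v t x = Literature.Analysis.UnboundedOperators.heatExtension (v s) (t - s) x - Literature.Analysis.FluidPDE.oseenDuhamel 1 s v v t x) → (∀ t < 0, Literature.Analysis.FluidPDE.VectorCalculus.IsDivFree (v t)) → (∀ s < 0, ∀ z : EuclideanSpace ℝ (Fin 3), Literature.Analysis.FluidPDE.cross (Literature.Analysis.FluidPDE.curlCLM (fderiv ℝ (v s) z)) ((fderiv ℝ (v s) z) (Literature.Analysis.FluidPDE.curlCLM (fderiv ℝ (v s) z))) = 0) → ∃ s : ℝ, s < 0 ∧ ∃ e : EuclideanSpace ℝ (Fin 3), e ≠ 0 ∧ ∀ z : EuclideanSpace ℝ (Fin 3), Literature.Analysis.FluidPDE.cross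 e (Literature.Analysis.FluidPDE.curlCLM (fderiv ℝ (v s) z)) = 0) :
    ∀ (C D : ℝ) (v : ℝ → EuclideanSpace ℝ (Fin 3) → EuclideanSpace ℝ (Fin 3)), Literature.Analysis.FluidPDE.HasTypeITimeDecay C v → Literature.Analysis.FluidPDE.HasTypeIDecay D v → ContinuousOn (Function.uncurry v) (Set.Iio (0 : ℝ) ×ˢ Set.univ) → (∀ s t : ℝ, s < t → t < 0 → ∀ x, v t x = Literature.Analysis.UnboundedOperators.heatExtension (v s) (t - s) x - Literature.Analysis.FluidPDE.oseenDuhamel 1 s v v t x) → (∀ t < 0, Literature.Analysis.FluidPDE.VectorCalculus.IsDivFree (v t)) → (∀ s < 0, ∃ U : Set (EuclideanSpace ℝ (Fin 3)), IsOpen U ∧ U.Nonempty ∧ ∀ z ∈ U, Literature.Analysis.FluidPDE.cross (Literature.Analysis.FluidPDE.curlCLM (fderiv ℝ (v s) z)) ((fderiv ℝ (v s) z) (Literature.Analysis.FluidPDE.curlCLM (fderiv ℝ (v s) z))) = 0) → ¬ Literature.Analysis.FluidPDE.IsBackwardSingularPoint v 0 := by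
  intro C D v hrate hdecay hcont hmild hdiv hwin
  obtain ⟨s, hs, e, he, hpar⟩ := hdir C D v hrate hdecay hcont hmild hdiv
    (Summit.NavierStokesRegularity.NavierStokesRegularity.Theorems.LocalTiltingFreeDoorDirectionLine.tiltingWindowToSlab
      C D v hrate hdecay hcont hmild hdiv hwin)
  exact not_backwardSingular_of_zero
    (Summit.NavierStokesRegularity.NavierStokesRegularity.Theorems.LocalTiltingFreeDoorDirectionLine.eq_zero_of_curl_parallel_slice
      hrate hcont hmild hdiv hs he hpar)

end Summit.NavierStokesRegularity.NavierStokesRegularity.Theorems.LocalTiltingFreeDoorSymmetricGerms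

end
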